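import Literature.MathematicalPhysics.QuantumFieldTheory.Balaban1983to89.B1Eq324BenfattoAppendixDWick
import Literature.MathematicalPhysics.QuantumFieldTheory.Balaban1983to89.B1Eq324WeightedCumulantLeaf
import HarnessLib

/-!
# `Balaban1983to89.B1Eq324BenfattoSect5CondToFree` — [BenfattoEtAl1978] §5 p. 153 / (5.31) p. 158, «(error)»: THE CONDITIONAL
# TRUNCATED EXPECTATIONS VERSUS THE FREE ONES for monomial clusters — generic form (ε-close diagram weights ⟹
# `2^{|Λ|}2^{2^{|Λ|}}|Λ|R^{|Λ|}ε`-close truncated functions), its instance `P̄(dz|z̄_Γ)` vs `P̂₀`, and the (C.7) suppliers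
# «far from ∪(∂□)» (`|u(x)|`, `|C − C^Γ|(x,y)` ≤ β·2dη·boundary sums), PROVED

statement-level skeleton of published theorems with citation tags; proofs where landed; nothing here is a claim about the
Yang–Mills mass gap

WHY THIS MODULE (cell `pub-ymgap`, seat `dag-n08-b`, node N08 «first missing estimate» lane; sequel of
`B1Eq324BenfattoAppendixDWick`).  The sketch of §5 (p. 153, verbatim): *"where 𝓔^T_z̄ denotes the truncated expectation with
respect to the conditioned measure. Such expectations are polynomials in the z̄ and differ very little from the ones we want
(i.e. the unconditional ones) if Δ₁, …, Δ_p are far from the region ∪_□(∂□) because the covariance of the z_Δ's decays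
exponentially and, far from ∪_□(∂□), coincides with the unconditional covariance."*  In the proof this is the step (5.31)
(p. 158): `𝓔^T_{z_{Γ₁}}(χ_□^b(H_{□′} + H_{□′,Γ₃(□)} − H_{Γ₄(□)} − H_{Γ₄(□),Γ₃(□)}), χ_□^b(H_{Γ₄(□)} + H_{Γ₄(□),Γ₃(□)}); k₁, k₂)`
`= 𝓔̂^T_0(… ; k₁, k₂) + (error)` *"and the error can be studied along the same lines of the argument leading to the bound (5.30)
and has the same form of (5.29) with new constants"*.  With the χ's removed ((5.29) first term, `…Sect5ChiToOne`) and the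
clusters expanded into monomials (multilinearity), the remaining comparison is between the joint truncated expectations of
MONOMIAL clusters under the conditioned free field `P̄ = condField d α β Γ z̄` (sources `u = condMean`, propagators
`C^Γ = condCov`; `…AppendixDWick`) and under the free field `P̂₀ = P0 d α β = condField … ∅` (sources `0`, propagators `C`).
Both are the SAME connected diagrams (`LegDiagram.ursellOf_dmoment`) with block weights that are ε-close on the legs whenever
`|u(x_l)| ≤ ε` and `|C^Γ(x_a,x_b) − C(x_a,x_b)| ≤ ε` — print's «far from ∪(∂□)».  This file proves the resulting bound (§1–§2) and
supplies `ε` through (C.7): the conditioned mean and `C − C^Γ` at a site `x ∉ Γ` are controlled by the Dirichlet covariance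
from `x` to the lattice neighbours of `Γ` (§3), whose decay is (C.6)+(C.2); only the corridor geometry is left to the boxes line.

WHAT IS PROVED (theorems only; no definition, no named fact, no `sorry`; axioms standard).
* §1 `abs_dval_sub_dval_le`, ★ **`abs_ursellOf_dmoment_sub_le`** — generic: two block-weight systems bounded by `R ≥ 1` and
  `ε`-close block by block have truncated diagram moments within `2^{|Λ|}·2^{2^{|Λ|}}·|Λ|·R^{|Λ|}·ε` on all the clusters
  (r14-lineage `B1Eq324WeightedCumulantLeaf.abs_prod_sub_prod_le` over the ≤ `|Λ|` blocks, r14's `card_diags_le`).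
* §2 ★★ **`abs_ursellOf_condField_sub_P0_le`** — the instance:
  `|𝓔^T_{z̄,Γ}(z^{A_j}, j∈J) − 𝓔^T_0(z^{A_j}, j∈J)| ≤ 2^{|Λ|}·2^{2^{|Λ|}}·|Λ|·R^{|Λ|}·ε` for legs with `|u(x_l)| ≤ ε`,
  `|C^Γ(x_a,x_b) − C(x_a,x_b)| ≤ ε` and a-priori `|u|, |C^Γ|, |C| ≤ R` (`…AppendixDWick.dmoment_eq_integral_prod` for `Γ` and for
  `∅` via `condField_empty`, `condMean_empty`, `condCov_empty`).
* §3 the SUPPLIERS of `ε` «far from ∪(∂□)», from (C.7) (`B1Eq324BenfattoMarkov.condMean_freeCov_eq_boundary_sum`) and (C.6):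
  **`abs_condMean_le_of_condCov_le`** (`|u(x)| ≤ β·2dη·Σ_{c∈Γ}|z̄_c|` when the Dirichlet covariance from `x` to the neighbours
  of `Γ` is `≤ η`), **`abs_freeCov_sub_condCov_le`** (`|C(x,y) − C^Γ(x,y)| ≤ β·2dη·Σ_{c∈Γ}C(c,y)`: the regression of the column
  `C(·,y)`), `condCov_nbrs_le_of_freeCov_le` (reduce `η` to the FREE covariance by (C.6), whose decay is (C.2)
  `…AppendixC2.freeCov_le_decay`).
* §4 **`abs_integral_prod_eval_condField_le`** — the a-priori moment size `|∫Π_{l∈s}z(x_l)dP̄| ≤ 2^{2^{|s|}}·K₀^{|s|}` from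
  leg-wise bounds `K₀` on `u`, `C^Γ` (the «point 2)» moment input of `…Sect5ChiToOne`, crude partition count).

HONEST SCOPE / NOT HERE.  The GEOMETRY turning §3's `η` into `e^{−δ·dist(legs, Γ)}` (distances from the deep box `□′` to
`Γ₁(□)` across `Γ₂(□)`, width `b^{3/2}`) is the boxes line's; the χ-carrying version (conditioned expectations of `Ψχ` — combine with
`…Sect5ChiToOne` on both sides); the corridor bookkeeping of (5.30)–(5.32) and «new constants»; the a-priori `R` on print's
objects is (C.6)/`B1Eq324BenfattoMarkov.abs_condCov_freeCov_le` (`|C^Γ| ≤ β⁻¹α⁻²`), `abs_freeCov_le`, and (C.8) for `u`.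
`BasicLemmaPrinted` stays OPEN.  NOT summit progress; count-neutral for N08; nothing of [Balaban1985UV3] is asserted.
-/

open Finset MeasureTheory
open scoped BigOperators

namespace Literature.MathematicalPhysics.QuantumFieldTheory.Balaban1983to89.B1Eq324BenfattoSect5CondToFree

open _root_.MeasureTheory _root_.ProbabilityTheory
open Literature.Probability.LatticeModels (IsSetPartition setPartitions mem_setPartitions ursellOf ursellOf_eq)
open Literature.Probability.LatticeModels.LegDiagram (legs mem_legs diags mem_diags IsDiag IsConn dval dmoment
  ursellOf_dmoment)
open Literature.MathematicalPhysics.QuantumFieldTheory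
open Literature.MathematicalPhysics.QuantumFieldTheory.Balaban1983to89.HiggsFluctMeasureWickPairings
  (pairVal pairVal_pair pairVal_of_card_ne_two)
open Literature.MathematicalPhysics.QuantumFieldTheory.Balaban1983to89.B1Eq323ConnectedGraphBound
  (allV some_mem_allV none_not_mem_allV isSetPartition_of_mem_diags card_le_of_isSetPartition card_diags_le)
open Literature.MathematicalPhysics.QuantumFieldTheory.Balaban1983to89.B1Eq324WeightedCumulantLeaf (abs_prod_sub_prod_le)
open Literature.MathematicalPhysics.QuantumFieldTheory.Balaban1983to89.B1Eq324BenfattoAppendixDWick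
  (dmoment_eq_integral_prod)
open Literature.MathematicalPhysics.QuantumFieldTheory.Balaban1983to89.B1Eq324BenfattoLemma

/-! ## §1  Two diagram-weight systems that are uniformly close: the truncated functions are close -/

section Generic

variable {J : Type} [Fintype J] [DecidableEq J] {Λ : Type} [Fintype Λ] [DecidableEq Λ] (own : Λ → J)
variable (w w' : Finset Λ → ℝ) (ω : Finset Λ → ℝ) {R ε : ℝ}

/-- Two diagrams with block weights bounded by `R ≥ 1` and `ε`-close block by block have `|Λ|·R^{|Λ|}·ε`-close values (on all the
clusters, no observable; telescoping `B1Eq324WeightedCumulantLeaf.abs_prod_sub_prod_le` over the `≤ |Λ|` blocks).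
[cite: BenfattoEtAl1978, (5.31) p.158] -/
theorem abs_dval_sub_dval_le (hR : 1 ≤ R) (hε : 0 ≤ ε) (hw : ∀ B, |w B| ≤ R) (hw' : ∀ B, |w' B| ≤ R)
    (hww' : ∀ B, |w B - w' B| ≤ ε) {g : Finset Λ × Finset (Finset Λ)} (hg : g ∈ diags own (allV J)) :
    |dval w ω (allV J) g - dval w' ω (allV J) g| ≤ Fintype.card Λ * R ^ Fintype.card Λ * ε := by
  have hπ := isSetPartition_of_mem_diags own hg
  rw [dval, dval, if_neg none_not_mem_allV, mul_one, mul_one]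
  have hcard : g.2.card ≤ Fintype.card Λ := (card_le_of_isSetPartition hπ).trans (card_univ (α := Λ)).le
  calc |∏ B ∈ g.2, w B - ∏ B ∈ g.2, w' B| ≤ g.2.card * R ^ g.2.card * ε :=
        abs_prod_sub_prod_le g.2 w w' hR hε (fun B _ => hw B) (fun B _ => hw' B) fun B _ => hww' B
    _ ≤ Fintype.card Λ * R ^ Fintype.card Λ * ε := by
        gcongr

/-- **CLOSE WEIGHTS ⟹ CLOSE TRUNCATED FUNCTIONS**: for two systems of block weights (sources + propagators) bounded by `R ≥ 1` and
`ε`-close on every block, the truncated functions of their diagram moments on all the clusters — both the sum over the SAME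
connected diagrams (`LegDiagram.ursellOf_dmoment`) — differ by at most `2^{|Λ|}·2^{2^{|Λ|}}·|Λ|·R^{|Λ|}·ε`.  The generic form of
«𝓔^T_{z̄} differ very little from the unconditional ones» (p. 153) / the «(error)» of (5.31). [cite: BenfattoEtAl1978, (5.31) p.158] -/
theorem abs_ursellOf_dmoment_sub_le [Nonempty J] (hR : 1 ≤ R) (hε : 0 ≤ ε) (hw : ∀ B, |w B| ≤ R) (hw' : ∀ B, |w' B| ≤ R)
    (hww' : ∀ B, |w B - w' B| ≤ ε) :
    |ursellOf (dmoment own w ω) (allV J) - ursellOf (dmoment own w' ω) (allV J)| ≤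
      2 ^ Fintype.card Λ * 2 ^ 2 ^ Fintype.card Λ * (Fintype.card Λ * R ^ Fintype.card Λ * ε) := by
  have hV : (allV J).Nonempty := by
    obtain ⟨j⟩ := ‹Nonempty J›
    exact ⟨some j, some_mem_allV j⟩
  rw [ursellOf_dmoment (own := own) w ω hV, ursellOf_dmoment (own := own) w' ω hV, ← sum_sub_distrib]
  have hB : 0 ≤ Fintype.card Λ * R ^ Fintype.card Λ * ε :=
    mul_nonneg (mul_nonneg (Nat.cast_nonneg _) (pow_nonneg (zero_le_one.trans hR) _)) hε
  refine (abs_sum_le_sum_abs _ _).trans (((sum_le_sum fun g hg =>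
    abs_dval_sub_dval_le own w w' ω hR hε hw hw' hww' (mem_filter.1 hg).1)).trans ?_)
  rw [sum_const, nsmul_eq_mul]
  exact mul_le_mul_of_nonneg_right ((by exact_mod_cast card_filter_le _ _ : _ ≤ _) |>.trans (card_diags_le own)) hB

end Generic

/-! ## §2  The conditioned free field versus the free field -/

section CondFree

variable {d : ℕ} {α β : ℝ}
variable {J : Type} [Fintype J] [DecidableEq J] {Λ : Type} [Fintype Λ] [LinearOrder Λ] (own : Λ → J)

/-- Locality of the Ursell function (private copy). [folklore] -/
private theorem ursellOf_congr {γ : Type*} [DecidableEq γ] {m m' : Finset γ → ℝ} {V : Finset γ}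
    (h : ∀ P ⊆ V, m P = m' P) : ursellOf m V = ursellOf m' V := by
  induction V using Finset.strongInduction with
  | H V ih =>
    rw [ursellOf_eq, ursellOf_eq, h V Subset.rfl]
    congr 1
    refine sum_congr rfl fun π hπ => prod_congr rfl fun P hP => ?_
    obtain ⟨hne, hπ'⟩ := mem_erase.1 hπ
    have hsp := mem_setPartitions.1 hπ'
    have hPV : P ⊂ V := hsp.ssubset_of_ne_singleton hne hP
    exact ih P hPV fun Q hQ => h Q (hQ.trans hPV.subset)

omit [Fintype J] [DecidableEq J] [Fintype Λ] in
/-- The block weights of the conditioned free field (sources `u(x_l)`, propagators `C^Γ(x_a,x_b)`, nothing larger) and of the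
free field (sources `0`, propagators `C(x_a,x_b)`): their common sup `R` and their distance `ε`, from leg-wise bounds. [folklore] -/
private theorem weight_bounds (Γ : Finset (B1Eq324BenfattoLemma.Site d)) (zbar : B1Eq324BenfattoLemma.Site d → ℝ)
    (x : Λ → B1Eq324BenfattoLemma.Site d) {R ε : ℝ} (hR0 : 0 ≤ R) (hε0 : 0 ≤ ε)
    (huR : ∀ l, |condMean (freeCov d α β) Γ zbar (x l)| ≤ R)
    (hCR : ∀ a b, |condCov (freeCov d α β) Γ (x a) (x b)| ≤ R)
    (hGR : ∀ a b, |freeCov d α β (x a) (x b)| ≤ R)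
    (huε : ∀ l, |condMean (freeCov d α β) Γ zbar (x l)| ≤ ε)
    (hCε : ∀ a b, |condCov (freeCov d α β) Γ (x a) (x b) - freeCov d α β (x a) (x b)| ≤ ε) (B : Finset Λ) :
    |(if B.card = 1 then ∏ l ∈ B, condMean (freeCov d α β) Γ zbar (x l)
        else pairVal (fun i j => condCov (freeCov d α β) Γ (x i) (x j)) B)| ≤ R ∧
      |(if B.card = 1 then ∏ l ∈ B, condMean (freeCov d α β) ∅ zbar (x l)
        else pairVal (fun i j => condCov (freeCov d α β) ∅ (x i) (x j)) B)| ≤ R ∧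
      |(if B.card = 1 then ∏ l ∈ B, condMean (freeCov d α β) Γ zbar (x l)
          else pairVal (fun i j => condCov (freeCov d α β) Γ (x i) (x j)) B) -
        (if B.card = 1 then ∏ l ∈ B, condMean (freeCov d α β) ∅ zbar (x l)
          else pairVal (fun i j => condCov (freeCov d α β) ∅ (x i) (x j)) B)| ≤ ε := by
  by_cases h1 : B.card = 1
  · obtain ⟨l, rfl⟩ := card_eq_one.1 h1
    simp only [card_singleton, if_true, prod_singleton, condMean_empty, sub_zero, abs_zero]
    exact ⟨huR l, hR0, huε l⟩
  · simp only [if_neg h1, condCov_empty]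
    by_cases h2 : B.card = 2
    · obtain ⟨a, b, hab, rfl⟩ := card_eq_two.1 h2
      rcases lt_or_gt_of_ne hab with h | h
      · rw [pairVal_pair _ h, pairVal_pair _ h]
        exact ⟨hCR a b, hGR a b, hCε a b⟩
      · rw [pair_comm, pairVal_pair _ h, pairVal_pair _ h]
        exact ⟨hCR b a, hGR b a, hCε b a⟩
    · rw [pairVal_of_card_ne_two _ h2, pairVal_of_card_ne_two _ h2, sub_zero, abs_zero]
      exact ⟨hR0, hR0, hε0⟩

/-- **(5.31)'s ERROR, GENERIC FORM: THE CONDITIONED VERSUS THE FREE TRUNCATED EXPECTATIONS OF MONOMIAL CLUSTERS** — «Such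
expectations are polynomials in the z̄ and differ very little from the ones we want (i.e. the unconditional ones) if Δ₁, …, Δ_p
are far from the region ∪(∂□)» (p. 153): for legs `x : Λ → Q₀` on which the conditioned mean is `ε`-small and the conditioned
covariance is `ε`-close to the free one (`|u(x_l)| ≤ ε`, `|C^Γ(x_a,x_b) − C(x_a,x_b)| ≤ ε`), with a common a-priori bound `R ≥ 1`
for `|u|, |C^Γ|, |C|` on the legs,
`|𝓔^T_{z̄,Γ}(z^{A_j}, j∈J) − 𝓔^T_0(z^{A_j}, j∈J)| ≤ 2^{|Λ|}·2^{2^{|Λ|}}·|Λ|·R^{|Λ|}·ε`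
(`P̂₀ = condField … ∅`, `B1Eq324BenfattoLemma.condField_empty`; both sides are the same connected diagrams with ε-close weights).
The QUANTITATIVE decay of `ε` in the distance of the legs from `Γ` is not derived here.
[cite: BenfattoEtAl1978, (5.31) p.158 and p.153] -/
theorem abs_ursellOf_condField_sub_P0_le [Nonempty J] (hα : 0 < α) (hβ : 0 < β)
    (Γ : Finset (B1Eq324BenfattoLemma.Site d)) (zbar : B1Eq324BenfattoLemma.Site d → ℝ)
    (x : Λ → B1Eq324BenfattoLemma.Site d) {R ε : ℝ} (hR : 1 ≤ R) (hε : 0 ≤ ε)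
    (huR : ∀ l, |condMean (freeCov d α β) Γ zbar (x l)| ≤ R)
    (hCR : ∀ a b, |condCov (freeCov d α β) Γ (x a) (x b)| ≤ R)
    (hGR : ∀ a b, |freeCov d α β (x a) (x b)| ≤ R)
    (huε : ∀ l, |condMean (freeCov d α β) Γ zbar (x l)| ≤ ε)
    (hCε : ∀ a b, |condCov (freeCov d α β) Γ (x a) (x b) - freeCov d α β (x a) (x b)| ≤ ε) :
    |ursellOf (fun P : Finset (Option J) => ∫ z, ∏ l ∈ legs own P, z (x l) ∂condField d α β Γ zbar) (allV J) -
        ursellOf (fun P : Finset (Option J) => ∫ z, ∏ l ∈ legs own P, z (x l) ∂P0 d α β) (allV J)| ≤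
      2 ^ Fintype.card Λ * 2 ^ 2 ^ Fintype.card Λ * (Fintype.card Λ * R ^ Fintype.card Λ * ε) := by
  set w : Finset Λ → ℝ := fun B => if B.card = 1 then ∏ l ∈ B, condMean (freeCov d α β) Γ zbar (x l)
      else pairVal (fun i j => condCov (freeCov d α β) Γ (x i) (x j)) B with hw
  set w' : Finset Λ → ℝ := fun B => if B.card = 1 then ∏ l ∈ B, condMean (freeCov d α β) ∅ zbar (x l)
      else pairVal (fun i j => condCov (freeCov d α β) ∅ (x i) (x j)) B with hw'
  have h1 : ursellOf (fun P : Finset (Option J) => ∫ z, ∏ l ∈ legs own P, z (x l) ∂condField d α β Γ zbar) (allV J)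
      = ursellOf (dmoment own w (fun _ => 0)) (allV J) :=
    ursellOf_congr fun P hP =>
      (dmoment_eq_integral_prod own hα hβ Γ zbar x (fun _ => 0) fun h => none_not_mem_allV (hP h)).symm
  have h2 : ursellOf (fun P : Finset (Option J) => ∫ z, ∏ l ∈ legs own P, z (x l) ∂P0 d α β) (allV J)
      = ursellOf (dmoment own w' (fun _ => 0)) (allV J) := by
    refine ursellOf_congr fun P hP => ?_
    rw [← condField_empty d α β zbar]
    exact (dmoment_eq_integral_prod own hα hβ ∅ zbar x (fun _ => 0) fun h => none_not_mem_allV (hP h)).symm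
  rw [h1, h2]
  have hWB := fun B => weight_bounds (α := α) (β := β) Γ zbar x (zero_le_one.trans hR) hε huR hCR hGR huε hCε B
  exact abs_ursellOf_dmoment_sub_le own w w' (fun _ => 0) hR hε (fun B => (hWB B).1) (fun B => (hWB B).2.1)
    fun B => (hWB B).2.2

end CondFree

/-! ## §3  «Far from ∪(∂□)»: the conditioned mean and the conditioned covariance versus the free one, through (C.7) -/

section FarFromBoundary

open Literature.MathematicalPhysics.QuantumFieldTheory.Balaban1983to89.B3Sect3VectorSelfEnergy (ZSite unitVec)
open Literature.MathematicalPhysics.QuantumFieldTheory.Balaban1983to89.B3CxiPropagator (hop)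
open Literature.MathematicalPhysics.QuantumFieldTheory.Balaban1983to89.B1Eq324BenfattoMarkov
  (condMean_freeCov_eq_boundary_sum)
open Literature.MathematicalPhysics.QuantumFieldTheory.Balaban1983to89.B1Eq324BenfattoAppendixC2
  (condCov_freeCov_nonneg_le condCov_eq_sub_condMean)

variable {d : ℕ} {α β : ℝ}

/-- **THE CONDITIONED MEAN IS SMALL FAR FROM `Γ`** ((C.7) + the smallness of the Dirichlet covariance between `x` and the
neighbours of `Γ`): if `0 ≤ C^Γ(x, c ± e_μ) ≤ η` for every `c ∈ Γ` and every direction (on print's lattice, by (C.6)+(C.2),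
`η = (βα²)⁻¹(1 + α²/2d)^{−dist(x, Γ±e)}`), then `|u(x)| ≤ β·(2d·η)·Σ_{c∈Γ}|z̄_c|` for `x ∉ Γ` — «far from ∪(∂□) … the covariance
… decays exponentially». [cite: BenfattoEtAl1978, p.153 and Appendix C (C.7) p.164] -/
theorem abs_condMean_le_of_condCov_le (hα : 0 < α) (hβ : 0 < β) (Γ : Finset (ZSite d)) (zbar : ZSite d → ℝ)
    {x : ZSite d} (hx : x ∉ Γ) {η : ℝ}
    (hη : ∀ c ∈ Γ, ∀ μ : Fin d, condCov (freeCov d α β) Γ x (c + unitVec μ) ≤ η ∧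
      condCov (freeCov d α β) Γ x (c - unitVec μ) ≤ η) :
    |condMean (freeCov d α β) Γ zbar x| ≤ β * (2 * d * η) * ∑ c ∈ Γ, |zbar c| := by
  rw [condMean_freeCov_eq_boundary_sum hα hβ Γ zbar hx, abs_mul, abs_of_pos hβ, mul_assoc]
  refine mul_le_mul_of_nonneg_left ?_ hβ.le
  rw [Finset.mul_sum]
  refine (Finset.abs_sum_le_sum_abs _ _).trans (Finset.sum_le_sum fun c hc => ?_)
  rw [abs_mul]
  refine mul_le_mul_of_nonneg_right ?_ (abs_nonneg _)
  have hnn : ∀ y, 0 ≤ condCov (freeCov d α β) Γ x y := fun y => (condCov_freeCov_nonneg_le hα hβ Γ x y).1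
  rw [hop, abs_of_nonneg (Finset.sum_nonneg fun μ _ => add_nonneg (hnn _) (hnn _))]
  calc ∑ μ : Fin d, (condCov (freeCov d α β) Γ x (c + unitVec μ) + condCov (freeCov d α β) Γ x (c - unitVec μ))
      ≤ ∑ _μ : Fin d, (η + η) := Finset.sum_le_sum fun μ _ => add_le_add (hη c hc μ).1 (hη c hc μ).2
    _ = 2 * d * η := by
        rw [Finset.sum_const, Finset.card_univ, Fintype.card_fin, nsmul_eq_mul]
        ring

/-- **THE CONDITIONED COVARIANCE COINCIDES WITH THE FREE ONE FAR FROM `Γ`, up to the same smallness**: since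
`C(x,y) − C^Γ(x,y)` is the regression mean at `x` of the boundary datum `c ↦ C(c,y)`
(`B1Eq324BenfattoAppendixC2.condCov_eq_sub_condMean`), the previous bound gives
`|C(x,y) − C^Γ(x,y)| ≤ β·(2d·η)·Σ_{c∈Γ} C(c,y)` for `x ∉ Γ` — small when `x` (through `η`) or `y` (through `Σ_{c∈Γ}C(c,y)`,
(C.2)) is far from `Γ`: «far from ∪(∂□), coincides with the unconditional covariance».
[cite: BenfattoEtAl1978, p.153 and Appendix C (C.6)–(C.7) p.164] -/
theorem abs_freeCov_sub_condCov_le (hα : 0 < α) (hβ : 0 < β) (Γ : Finset (ZSite d)) {x : ZSite d} (hx : x ∉ Γ)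
    (y : ZSite d) {η : ℝ}
    (hη : ∀ c ∈ Γ, ∀ μ : Fin d, condCov (freeCov d α β) Γ x (c + unitVec μ) ≤ η ∧
      condCov (freeCov d α β) Γ x (c - unitVec μ) ≤ η) :
    |freeCov d α β x y - condCov (freeCov d α β) Γ x y| ≤ β * (2 * d * η) * ∑ c ∈ Γ, freeCov d α β c y := by
  have h := abs_condMean_le_of_condCov_le hα hβ Γ (fun c => freeCov d α β c y) hx hη
  rw [condCov_eq_sub_condMean, sub_sub_cancel]
  refine h.trans_eq ?_
  congr 1
  refine Finset.sum_congr rfl fun c _ => abs_of_nonneg ?_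
  have h0 := (condCov_freeCov_nonneg_le hα hβ ∅ c y).1
  rwa [condCov_empty] at h0

/-- The Dirichlet covariance between `x` and a site `a` is at most the free one, hence at most (C.2)'s bound: the supplier of
`η` above is `B1Eq324BenfattoAppendixC2.freeCov_le_decay` at the neighbours of `Γ` (stated here as the monotone reduction
`C^Γ(x,a) ≤ C(x,a) ≤ η` from any leg-wise free bound). [cite: BenfattoEtAl1978, Appendix C (C.2), (C.6) p.164] -/
theorem condCov_nbrs_le_of_freeCov_le (hα : 0 < α) (hβ : 0 < β) (Γ : Finset (ZSite d)) (x : ZSite d) {η : ℝ}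
    (hη : ∀ c ∈ Γ, ∀ μ : Fin d, freeCov d α β x (c + unitVec μ) ≤ η ∧ freeCov d α β x (c - unitVec μ) ≤ η) :
    ∀ c ∈ Γ, ∀ μ : Fin d, condCov (freeCov d α β) Γ x (c + unitVec μ) ≤ η ∧
      condCov (freeCov d α β) Γ x (c - unitVec μ) ≤ η :=
  fun c hc μ => ⟨(condCov_freeCov_nonneg_le hα hβ Γ x _).2.trans (hη c hc μ).1,
    (condCov_freeCov_nonneg_le hα hβ Γ x _).2.trans (hη c hc μ).2⟩

end FarFromBoundary

/-! ## §4  The a-priori size of the moments of monomials under `P̄` («point 2)» of Appendix C as a moment input) -/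

section MomentBound

open Literature.MathematicalPhysics.QuantumFieldTheory.Balaban1983to89.B1Eq324BenfattoAppendixDWick
  (integral_prod_eval_condField_eq_sum_setPartitions)

variable {d : ℕ} {α β : ℝ} {κ : Type} [LinearOrder κ]

/-- The number of set partitions of a finite set is at most `2^{2^{|s|}}` (they are families of subsets). [folklore] -/
private theorem card_setPartitions_le (s : Finset κ) : ((setPartitions s).card : ℝ) ≤ 2 ^ 2 ^ s.card := by
  classical
  have h : (setPartitions s).card ≤ s.powerset.powerset.card := by
    unfold Literature.Probability.LatticeModels.setPartitions
    exact card_filter_le _ _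
  rw [card_powerset, card_powerset] at h
  exact_mod_cast h

/-- **A-PRIORI MOMENTS OF MONOMIALS UNDER THE CONDITIONED FREE FIELD**: if `|u(x_l)| ≤ K₀` and `|C^Γ(x_a,x_b)| ≤ K₀` on the legs
(`K₀ ≥ 1`; (C.8) and (C.6)), then `|∫ Π_{l∈s} z(x_l) dP̄| ≤ 2^{2^{|s|}}·K₀^{|s|}` — the moment input «point 2)» that
`…Sect5ChiToOne` consumes for print's polynomial slots (each set partition contributes a product of ≤ |s| weights ≤ K₀).
[cite: BenfattoEtAl1978, Appendix C 2) p.164 and Appendix D p.165] -/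
theorem abs_integral_prod_eval_condField_le (hα : 0 < α) (hβ : 0 < β) (Γ : Finset (B1Eq324BenfattoLemma.Site d))
    (zbar : B1Eq324BenfattoLemma.Site d → ℝ) (s : Finset κ) (x : κ → B1Eq324BenfattoLemma.Site d) {K₀ : ℝ}
    (hK₀ : 1 ≤ K₀) (hu : ∀ l, |condMean (freeCov d α β) Γ zbar (x l)| ≤ K₀)
    (hC : ∀ a b, |condCov (freeCov d α β) Γ (x a) (x b)| ≤ K₀) :
    |∫ z, ∏ l ∈ s, z (x l) ∂condField d α β Γ zbar| ≤ 2 ^ 2 ^ s.card * K₀ ^ s.card := by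
  rw [integral_prod_eval_condField_eq_sum_setPartitions hα hβ Γ zbar s x]
  have hblock : ∀ B : Finset κ, |(if B.card = 1 then ∏ l ∈ B, condMean (freeCov d α β) Γ zbar (x l)
      else pairVal (fun i j => condCov (freeCov d α β) Γ (x i) (x j)) B)| ≤ K₀ := by
    intro B
    by_cases h1 : B.card = 1
    · obtain ⟨l, rfl⟩ := card_eq_one.1 h1
      simp only [card_singleton, if_true, prod_singleton]
      exact hu l
    · rw [if_neg h1]
      by_cases h2 : B.card = 2
      · obtain ⟨a, b, hab, rfl⟩ := card_eq_two.1 h2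
        rcases lt_or_gt_of_ne hab with h | h
        · rw [pairVal_pair _ h]
          exact hC a b
        · rw [pair_comm, pairVal_pair _ h]
          exact hC b a
      · rw [pairVal_of_card_ne_two _ h2, abs_zero]
        exact zero_le_one.trans hK₀
  have hterm : ∀ τ ∈ setPartitions s, |∏ B ∈ τ, (if B.card = 1 then ∏ l ∈ B, condMean (freeCov d α β) Γ zbar (x l)
      else pairVal (fun i j => condCov (freeCov d α β) Γ (x i) (x j)) B)| ≤ K₀ ^ s.card := by
    intro τ hτ
    have hπ := mem_setPartitions.1 hτ
    rw [Finset.abs_prod]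
    calc ∏ B ∈ τ, |(if B.card = 1 then ∏ l ∈ B, condMean (freeCov d α β) Γ zbar (x l)
            else pairVal (fun i j => condCov (freeCov d α β) Γ (x i) (x j)) B)|
        ≤ ∏ _B ∈ τ, K₀ := prod_le_prod (fun B _ => abs_nonneg _) fun B _ => hblock B
      _ = K₀ ^ τ.card := prod_const K₀
      _ ≤ K₀ ^ s.card := pow_le_pow_right₀ hK₀ (card_le_of_isSetPartition hπ)
  refine (abs_sum_le_sum_abs _ _).trans ((sum_le_sum hterm).trans ?_)
  rw [sum_const, nsmul_eq_mul]
  exact mul_le_mul_of_nonneg_right (card_setPartitions_le s) (pow_nonneg (zero_le_one.trans hK₀) _)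

end MomentBound

end Literature.MathematicalPhysics.QuantumFieldTheory.Balaban1983to89.B1Eq324BenfattoSect5CondToFree
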